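import Summits.BirchSwinnertonDyer.BirchSwinnertonDyer.Theorems.Rank2Observatory2DescKillTernary
import HarnessLib

/-!
# BirchSwinnertonDyer — SEL2CUBIC kill layer: the CONIC-OBSTRUCTION certificate in RESIDUE form
# («no `p`-primitive integer vector with `p^N ∣ Q₁, Q₂`»), the form a `2`-Selmer class contradicts

HONEST FRAMING: route `ShaPrimaryTransfer`, seat `bsd-line-spt-p1` (g31), `--supports` item T =
`FiniteShaComponentTransfer` (stmt-22356), UNCHANGED (conjecture-grade at corank ≥ 2). BSD in rank ≥ 2 is NOT
proved by any of this. THEOREMS ONLY.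

The census kill certificate `conicCert` (`Rank2Observatory2DescKillTernary`: the conic `C = c₁q₁ + c₂q₂` of a class,
`c₁t₁ + c₂t₂ = 0`, coefficient form `cqCoef = e·κ`, ternary residue tree `conicCheck p κ fuel`) concludes
`TwoDescKill.KillValidAt` — «the quadric pair `killQ` has no INTEGER zero primitive at `p`» (`conicCert_sound`). A
`2`-Selmer class is everywhere locally soluble, so for it only the RESIDUE statement is usable (g30's kill layer:
`…SelmerCubicKillCertMod*`, `…KillSelList.admKillsV_sound_sel`, `…KillLocal.exists_primitive_killQ_dvd_of_forall_extension`).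
This file re-reads the conic certificate in that form:

* `cnode_sound_mod`, `conicCheck_sound_mod` — the ternary residue tree excludes every `p`-primitive `X` with
  `p^{1+fuel} ∣ κ(X)` (the tree's own mechanism; adapted from `cnode_sound` / `conicCheck_sound`, the exact zero
  replaced by divisibility at the working precision);
* `cq_eq_killQ` — `C(r) = c₁Q₁(v) + c₂Q₂(v) − (c₁t₁ + c₂t₂)n²` identically (`v = (r, n)`);
* `zsq_fst_smul`, `zsq_snd_smul` — the two quadrics of the class are homogeneous of degree `2` in `r`;
* **`killResidue_of_conicCert`** — `conicCertCheck … = true ∧ conicCheck p κ fuel = true ⟹ ∃ N, no p-primitive v ∈ ℤ⁴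
  with p^N ∣ Q₁(v), Q₂(v)`: with `N = fuel + 2 + v_p(e) + v_p(t₁)`, `p^N ∣ Q₁, Q₂` gives `p^N ∣ C(r) = e·d²·κ(X)` for
  `r = d·X`, `X` the primitive part of `r ≠ 0`; `2·v_p(d) ≤ v_p(t₁)` because `p^{v_p(t₁)+1} ∣ d²` would force
  `p^{v_p(t₁)+1} ∣ t₁n²` with `p ∤ n`; hence `p^{1+fuel} ∣ κ(X)`, excluded by the tree.
So the `conicCert` kills of the census (validity-form rows of `TwoDescClQ2K*`, `…E2Q2*`, `…OmegaD*`) have the residue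
form consumed by `killResidueQ2_cons` / `killResidueE2Q_cons_z` / `killResidueD_cons_z`.
Elementary (congruences, gcd, `p`-adic valuations of integers). [cite: Cassels1991LecturesEllipticCurves, §15]
[cite: CremonaAlgorithms1997, §3.6]
-/

-- single-conjunct summit: `Summit.BirchSwinnertonDyer.BirchSwinnertonDyer.…` repeats the name by design
set_option linter.dupNamespace false

namespace Summit.BirchSwinnertonDyer.BirchSwinnertonDyer.Theorems.ShaPrimaryTransferSelmerCubicKill

open Summit.BirchSwinnertonDyer.BirchSwinnertonDyer.Rank2Observatory
open Summit.BirchSwinnertonDyer.BirchSwinnertonDyer.Rank2Observatory.TwoDescKill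

/-! ## The ternary residue tree in residue form -/

/-- **Node soundness, residue form**: if `cnode p κ ch f s t k = true` then no point `X` of chart `ch` congruent to
the node (free coordinates `≡ (s, t) (mod p^k)`, normalised coordinate `≡ 1 (mod p^(k+f))`) has
`p^(k+f) ∣ κ(X)`. (The tree's proof, the exact zero replaced by divisibility at the working precision.)
[cite: CremonaAlgorithms1997, §3.6] -/
theorem cnode_sound_mod {p : ℕ} (hp : p.Prime) (κ : ℤ × ℤ × ℤ × ℤ × ℤ × ℤ) (ch : ℕ) :
    ∀ (f : ℕ) (s t : ℤ) (k : ℕ), cnode p κ ch f s t k = true → ∀ X : ℤ × ℤ × ℤ,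
      ((p ^ k : ℕ) : ℤ) ∣ cfree1 ch X - s → ((p ^ k : ℕ) : ℤ) ∣ cfree2 ch X - t →
      ((p ^ (k + f) : ℕ) : ℤ) ∣ cfix ch X - 1 → ((p ^ (k + f) : ℕ) : ℤ) ∣ ternEval κ X → False := by
  intro f
  induction f with
  | zero =>
      intro s t k h X h1 h2 h3 hX
      simp only [cnode] at h
      obtain ⟨e1, e2, e3⟩ := cpt_congr ch X s t _ h1 h2 (by simpa using h3)
      have hc := ternEval_congr κ (p ^ k) (cpt ch s t) X e1 e2 e3
      have hX' : ((p ^ k : ℕ) : ℤ) ∣ ternEval κ X := by simpa using hX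
      have h' := dvd_sub hX' hc
      rw [sub_sub_cancel] at h'
      exact cdead_sound h h'
  | succ f ih =>
      intro s t k h X h1 h2 h3 hX
      simp only [cnode, Bool.or_eq_true, List.all_eq_true, List.mem_range] at h
      have hpk : ((p ^ k : ℕ) : ℤ) ∣ ((p ^ (k + (f + 1)) : ℕ) : ℤ) :=
        Int.natCast_dvd_natCast.mpr (pow_dvd_pow p (by omega))
      rcases h with hd | hall
      · obtain ⟨e1, e2, e3⟩ := cpt_congr ch X s t _ h1 h2 (hpk.trans h3)
        have hc := ternEval_congr κ (p ^ k) (cpt ch s t) X e1 e2 e3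
        have h' := dvd_sub (hpk.trans hX) hc
        rw [sub_sub_cancel] at h'
        exact cdead_sound hd h'
      · have hkf : k + 1 + f = k + (f + 1) := by ring
        obtain ⟨d₁, hd₁, g₁⟩ := exists_digit hp.pos (p ^ k) h1
        obtain ⟨d₂, hd₂, g₂⟩ := exists_digit hp.pos (p ^ k) h2
        have g₁' : ((p ^ (k + 1) : ℕ) : ℤ) ∣ cfree1 ch X - (s + (p : ℤ) ^ k * (d₁ : ℤ)) := by
          push_cast at g₁ ⊢; rw [pow_succ]; exact g₁
        have g₂' : ((p ^ (k + 1) : ℕ) : ℤ) ∣ cfree2 ch X - (t + (p : ℤ) ^ k * (d₂ : ℤ)) := by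
          push_cast at g₂ ⊢; rw [pow_succ]; exact g₂
        exact ih _ _ (k + 1) (hall d₁ hd₁ d₂ hd₂) X g₁' g₂' (by rw [hkf]; exact h3) (by rw [hkf]; exact hX)

/-- **Soundness of the conic-obstruction certificate, residue form**: if `conicCheck p κ fuel = true` for a prime
`p`, then no integer `(x, y, w)` with `p ∤ (x, y, w)` has `p^(1+fuel) ∣ κ(x, y, w)`.
[cite: CremonaAlgorithms1997, §3.6] -/
theorem conicCheck_sound_mod {p : ℕ} (hp : p.Prime) {κ : ℤ × ℤ × ℤ × ℤ × ℤ × ℤ} {fuel : ℕ}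
    (h : conicCheck p κ fuel = true) (x y w : ℤ)
    (hprim : ¬ ((p : ℤ) ∣ x ∧ (p : ℤ) ∣ y ∧ (p : ℤ) ∣ w))
    (h0 : ((p ^ (1 + fuel) : ℕ) : ℤ) ∣ ternEval κ (x, y, w)) : False := by
  have hp0 : 0 < p := hp.pos
  have hpZ : Prime (p : ℤ) := Nat.prime_iff_prime_int.mp hp
  simp only [conicCheck, Bool.and_eq_true, List.all_eq_true, List.mem_range] at h
  obtain ⟨⟨hc0, hc1⟩, hc2⟩ := h
  have unit_of : ∀ r : ℤ, ¬ (p : ℤ) ∣ r → ∃ l e : ℤ, l * r + e * (p : ℤ) ^ (1 + fuel) = 1 := by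
    intro r hr
    have hcop : IsCoprime r ((p : ℤ) ^ (1 + fuel)) :=
      ((Prime.coprime_iff_not_dvd hpZ).mpr hr).symm.pow_right
    obtain ⟨l, e, hle⟩ := hcop
    exact ⟨l, e, hle⟩
  have digit : ∀ r : ℤ, ∃ d : ℕ, d < p ∧ (p : ℤ) ∣ r - d := by
    intro r
    have hp' : (0 : ℤ) < p := by exact_mod_cast hp0
    refine ⟨(r % (p : ℤ)).toNat, ?_, r / p, ?_⟩
    · have := Int.emod_lt_of_pos r hp'; have := Int.emod_nonneg r hp'.ne'; omega
    · rw [Int.toNat_of_nonneg (Int.emod_nonneg r hp'.ne')]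
      linear_combination (-1 : ℤ) * Int.emod_add_ediv_mul r (p : ℤ)
  have scaled : ∀ l : ℤ, ((p ^ (1 + fuel) : ℕ) : ℤ) ∣ ternEval κ (l * x, l * y, l * w) := by
    intro l; rw [ternEval_smul]; exact dvd_mul_of_dvd_right h0 _
  have fix1 : ∀ l e r : ℤ, l * r + e * (p : ℤ) ^ (1 + fuel) = 1 →
      ((p ^ (1 + fuel) : ℕ) : ℤ) ∣ l * r - 1 := by
    intro l e r hle; push_cast; exact ⟨-e, by linear_combination hle⟩
  by_cases hw : (p : ℤ) ∣ w
  · by_cases hy : (p : ℤ) ∣ y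
    · have hx : ¬ (p : ℤ) ∣ x := fun hx => hprim ⟨hx, hy, hw⟩
      obtain ⟨l, e, hle⟩ := unit_of x hx
      refine cnode_sound_mod hp κ 2 fuel 0 0 1 hc2 (l * x, l * y, l * w) ?_ ?_ ?_ (scaled l)
      · simpa [cfree1] using dvd_mul_of_dvd_right hy l
      · simpa [cfree2] using dvd_mul_of_dvd_right hw l
      · simpa [cfix] using fix1 l e x hle
    · obtain ⟨l, e, hle⟩ := unit_of y hy
      obtain ⟨d, hd, g⟩ := digit (l * x)
      refine cnode_sound_mod hp κ 1 fuel (d : ℤ) 0 1 (hc1 d hd) (l * x, l * y, l * w)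
        ?_ ?_ ?_ (scaled l)
      · simpa [cfree1] using g
      · simpa [cfree2] using dvd_mul_of_dvd_right hw l
      · simpa [cfix] using fix1 l e y hle
  · obtain ⟨l, e, hle⟩ := unit_of w hw
    obtain ⟨d₁, hd₁, g₁⟩ := digit (l * x)
    obtain ⟨d₂, hd₂, g₂⟩ := digit (l * y)
    refine cnode_sound_mod hp κ 0 fuel (d₁ : ℤ) (d₂ : ℤ) 1 (hc0 d₁ hd₁ d₂ hd₂)
      (l * x, l * y, l * w) ?_ ?_ ?_ (scaled l)
    · simpa [cfree1] using g₁
    · simpa [cfree2] using g₂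
    · simpa [cfix] using fix1 l e w hle

/-! ## The quadric pair and the conic -/

/-- `C(r) = c₁Q₁(v) + c₂Q₂(v) − (c₁t₁ + c₂t₂)·n²` identically, `v = (r₀, r₁, r₂, n)`. [folklore] -/
theorem cq_eq_killQ {R : Type*} [CommRing R] (a b c : R) (z : R × R × R) (c₁ c₂ t₁ t₂ r₀ r₁ r₂ n : R) :
    cq a b c z c₁ c₂ (r₀, r₁, r₂) =
      c₁ * (killQ a b c z t₁ t₂ (r₀, r₁, r₂, n)).1 + c₂ * (killQ a b c z t₁ t₂ (r₀, r₁, r₂, n)).2 -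
        (c₁ * t₁ + c₂ * t₂) * n ^ 2 := by
  simp only [killQ, zsq, cq, hq, lz]
  ring

/-- The first quadric `(z·r²)_α` is homogeneous of degree `2` in `r`. [folklore] -/
theorem zsq_fst_smul {R : Type*} [CommRing R] (a b c : R) (z : R × R × R) (l x y w : R) :
    (zsq a b c z (l * x, l * y, l * w)).2.1 = l ^ 2 * (zsq a b c z (x, y, w)).2.1 := by
  simp only [zsq, mul3]; ring

/-- The second quadric `(z·r²)_{α²}` is homogeneous of degree `2` in `r`. [folklore] -/
theorem zsq_snd_smul {R : Type*} [CommRing R] (a b c : R) (z : R × R × R) (l x y w : R) :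
    (zsq a b c z (l * x, l * y, l * w)).2.2 = l ^ 2 * (zsq a b c z (x, y, w)).2.2 := by
  simp only [zsq, mul3]; ring

/-! ## The conic kill in residue form -/

/-- **The conic-obstruction kill in RESIDUE form.** With `conicCertCheck a b c z t₁ t₂ c₁ c₂ e κ = true`
(`c₁t₁ + c₂t₂ = 0`, `t₁ ≠ 0`, `e ≠ 0`, `cqCoef = e·κ`) and `conicCheck p κ fuel = true` there is `N`
(namely `fuel + 2 + v_p(e) + v_p(t₁)`) such that no integer vector `v` primitive at `p` has `p^N ∣ Q₁(v)` and
`p^N ∣ Q₂(v)` — the hypothesis shape of `admKillsV_sound_sel` / `killResidueQ2_cons` / `killResidueE2Q_cons_z` /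
`killResidueD_cons_z`, so the census `conicCert` kills become Selmer-sound.
[cite: Cassels1991LecturesEllipticCurves, §15] [cite: CremonaAlgorithms1997, §3.6] -/
theorem killResidue_of_conicCert {p : ℕ} (hp : p.Prime) {a b c : ℤ} {z : ℤ × ℤ × ℤ} {t₁ t₂ c₁ c₂ e : ℤ}
    {κ : ℤ × ℤ × ℤ × ℤ × ℤ × ℤ} {fuel : ℕ} (hc : conicCertCheck a b c z t₁ t₂ c₁ c₂ e κ = true)
    (hk : conicCheck p κ fuel = true) :
    ∃ N : ℕ, ∀ v : ℤ × ℤ × ℤ × ℤ,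
      ¬ ((p : ℤ) ∣ v.1 ∧ (p : ℤ) ∣ v.2.1 ∧ (p : ℤ) ∣ v.2.2.1 ∧ (p : ℤ) ∣ v.2.2.2) →
      (p : ℤ) ^ N ∣ (killQ a b c z t₁ t₂ v).1 → (p : ℤ) ^ N ∣ (killQ a b c z t₁ t₂ v).2 → False := by
  haveI := Fact.mk hp
  have hpZ : Prime (p : ℤ) := Nat.prime_iff_prime_int.mp hp
  simp only [conicCertCheck, Bool.and_eq_true, decide_eq_true_eq] at hc
  obtain ⟨⟨⟨hct, ht⟩, he⟩, hκ⟩ := hc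
  set B := padicValInt p t₁ with hB
  set A := padicValInt p e with hA
  refine ⟨fuel + 2 + A + B, ?_⟩
  rintro ⟨r₀, r₁, r₂, n⟩ hprim h1 h2
  dsimp only at hprim h1 h2
  -- the power `p^N` divides `C(r) = e · κ(r)`
  have hN1 : B + 1 ≤ fuel + 2 + A + B := by omega
  have hC : (p : ℤ) ^ (fuel + 2 + A + B) ∣ e * ternEval κ (r₀, r₁, r₂) := by
    have h := dvd_add (dvd_mul_of_dvd_right h1 c₁) (dvd_mul_of_dvd_right h2 c₂)
    rw [← ternEval_smul6, ← hκ, ← cq_ternEval, cq_eq_killQ a b c z c₁ c₂ t₁ t₂ r₀ r₁ r₂ n, hct]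
    simpa using h
  -- `r ≠ 0`: otherwise `p^N ∣ t₁ n²` with `p ∤ n`
  have hpn_of : (p : ℤ) ∣ r₀ → (p : ℤ) ∣ r₁ → (p : ℤ) ∣ r₂ → ¬ (p : ℤ) ∣ n :=
    fun h0 h1' h2' hn => hprim ⟨h0, h1', h2', hn⟩
  have key : ∀ m : ℕ, (p : ℤ) ^ m ∣ t₁ * n ^ 2 → ¬ (p : ℤ) ∣ n → m ≤ B := by
    intro m hm hn
    have hcop : IsCoprime ((p : ℤ) ^ m) (n ^ 2) :=
      (((Prime.coprime_iff_not_dvd hpZ).mpr hn).pow_right).pow_left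
    have ht₁ : (p : ℤ) ^ m ∣ t₁ := hcop.dvd_of_dvd_mul_right hm
    rcases (padicValInt_dvd_iff (p := p) m t₁).mp ht₁ with h | h
    · exact absurd h ht
    · exact h
  have hr0 : ¬ (r₀ = 0 ∧ r₁ = 0 ∧ r₂ = 0) := by
    rintro ⟨e0, e1, e2⟩
    subst e0 e1 e2
    have h1' : (p : ℤ) ^ (fuel + 2 + A + B) ∣ t₁ * n ^ 2 := by
      simpa [killQ, zsq, mul3] using h1
    have hn : ¬ (p : ℤ) ∣ n := hpn_of (dvd_zero _) (dvd_zero _) (dvd_zero _)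
    have := key _ h1' hn
    omega
  -- divide `r` by the gcd `d` of its coordinates: `r = d • X`, `X` primitive at every prime
  obtain ⟨g, hg⟩ : ∃ g : ℕ, Int.gcd (Int.gcd r₀ r₁ : ℤ) r₂ = g := ⟨_, rfl⟩
  have hg0 : 0 < g := by
    rw [← hg]; apply Nat.pos_of_ne_zero; intro h
    rw [Int.gcd_eq_zero_iff] at h
    obtain ⟨h01, h2'⟩ := h
    have h01' : Int.gcd r₀ r₁ = 0 := by exact_mod_cast h01
    rw [Int.gcd_eq_zero_iff] at h01'
    exact hr0 ⟨h01'.1, h01'.2, h2'⟩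
  have hg01 : (g : ℤ) ∣ (Int.gcd r₀ r₁ : ℤ) := hg ▸ Int.gcd_dvd_left _ _
  have d0 : (g : ℤ) ∣ r₀ := hg01.trans (Int.gcd_dvd_left _ _)
  have d1 : (g : ℤ) ∣ r₁ := hg01.trans (Int.gcd_dvd_right _ _)
  have d2 : (g : ℤ) ∣ r₂ := hg ▸ Int.gcd_dvd_right _ _
  obtain ⟨x, hx⟩ := d0
  obtain ⟨y, hy⟩ := d1
  obtain ⟨w, hw⟩ := d2
  have hgZ : (g : ℤ) ≠ 0 := by exact_mod_cast hg0.ne'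
  have hprim' : ¬ ((p : ℤ) ∣ x ∧ (p : ℤ) ∣ y ∧ (p : ℤ) ∣ w) := by
    rintro ⟨⟨x', ex⟩, ⟨y', ey⟩, ⟨w', ew⟩⟩
    have e0 : ((p * g : ℕ) : ℤ) ∣ r₀ := ⟨x', by rw [hx, ex]; push_cast; ring⟩
    have e1 : ((p * g : ℕ) : ℤ) ∣ r₁ := ⟨y', by rw [hy, ey]; push_cast; ring⟩
    have e2 : ((p * g : ℕ) : ℤ) ∣ r₂ := ⟨w', by rw [hw, ew]; push_cast; ring⟩
    have h01 : p * g ∣ Int.gcd r₀ r₁ := Int.dvd_gcd e0 e1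
    have hdg : p * g ∣ Int.gcd (Int.gcd r₀ r₁ : ℤ) r₂ :=
      Int.dvd_gcd (Int.natCast_dvd_natCast.mpr h01) e2
    rw [hg] at hdg
    have hle := Nat.le_of_dvd hg0 hdg
    have hp2 := hp.two_le
    nlinarith
  -- `2·v_p(d) ≤ v_p(t₁)`: otherwise `p^{B+1} ∣ d² ∣ q₁(r)` and `p^{B+1} ∣ Q₁(v)` give `p^{B+1} ∣ t₁n²`, `p ∤ n`
  have hq1 : (killQ a b c z t₁ t₂ (r₀, r₁, r₂, n)).1 =
      (g : ℤ) ^ 2 * (zsq a b c z (x, y, w)).2.1 + t₁ * n ^ 2 := by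
    simp only [killQ, hx, hy, hw, zsq_fst_smul]
  have hvd : 2 * padicValInt p g ≤ B := by
    by_contra hlt
    push Not at hlt
    have hdvd_g : (p : ℤ) ^ (B + 1) ∣ (g : ℤ) ^ 2 :=
      (padicValInt_dvd_iff (p := p) (B + 1) ((g : ℤ) ^ 2)).mpr
        (Or.inr (by rw [pow_two, padicValInt.mul hgZ hgZ]; omega))
    have hp_g : (p : ℤ) ∣ (g : ℤ) := by
      have h1g : 1 ≤ padicValInt p g := by omega
      have := (padicValInt_dvd_iff (p := p) 1 (g : ℤ)).mpr (Or.inr h1g)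
      simpa using this
    have hn : ¬ (p : ℤ) ∣ n :=
      hpn_of (hx ▸ dvd_mul_of_dvd_left hp_g x) (hy ▸ dvd_mul_of_dvd_left hp_g y) (hw ▸ dvd_mul_of_dvd_left hp_g w)
    have hQ : (p : ℤ) ^ (B + 1) ∣ (killQ a b c z t₁ t₂ (r₀, r₁, r₂, n)).1 :=
      (pow_dvd_pow (p : ℤ) hN1).trans h1
    rw [hq1] at hQ
    have htn : (p : ℤ) ^ (B + 1) ∣ t₁ * n ^ 2 := by
      have := dvd_sub hQ (dvd_mul_of_dvd_left hdvd_g ((zsq a b c z (x, y, w)).2.1))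
      simpa using this
    have := key _ htn hn
    omega
  -- hence `p^{1+fuel} ∣ κ(X)`
  have hκr : ternEval κ (r₀, r₁, r₂) = (g : ℤ) ^ 2 * ternEval κ (x, y, w) := by
    rw [hx, hy, hw, ternEval_smul]
  rw [hκr] at hC
  by_cases hκ0 : ternEval κ (x, y, w) = 0
  · exact conicCheck_sound hp hk x y w hprim' hκ0
  have hne : e * ((g : ℤ) ^ 2 * ternEval κ (x, y, w)) ≠ 0 :=
    mul_ne_zero he (mul_ne_zero (pow_ne_zero 2 hgZ) hκ0)
  have hval := ((padicValInt_dvd_iff (p := p) _ _).mp hC).resolve_left hne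
  rw [padicValInt.mul he (mul_ne_zero (pow_ne_zero 2 hgZ) hκ0),
    padicValInt.mul (pow_ne_zero 2 hgZ) hκ0, pow_two, padicValInt.mul hgZ hgZ] at hval
  have hfin : 1 + fuel ≤ padicValInt p (ternEval κ (x, y, w)) := by omega
  have hdiv : ((p ^ (1 + fuel) : ℕ) : ℤ) ∣ ternEval κ (x, y, w) := by
    push_cast
    exact (padicValInt_dvd_iff (p := p) _ _).mpr (Or.inr hfin)
  exact conicCheck_sound_mod hp hk x y w hprim' hdiv

end Summit.BirchSwinnertonDyer.BirchSwinnertonDyer.Theorems.ShaPrimaryTransferSelmerCubicKill
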